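import Mathlib.Algebra.Module.LinearMap.End
import Mathlib.Algebra.Module.Basic
import Mathlib.GroupTheory.Coset.Card
import Mathlib.RingTheory.IntegralDomain
import HarnessLib

/-!
# Crux K1 `CumulativeHeegnerInclusionAtThree` (stmt-BirchSwinnertonDyer-24198), line `birth` — STUB A,
# first lemma of the route's TWO-LAYER PLAN (a) «CumulativeClass»: the cumulative resolvent identity
# `Tr y♮_{m+1} = p · y♮_m` on a TRACE-ZERO tower, in abstract form

Width seat bsd-line-chl-k1-p1-w2 (`--supports stmt-BirchSwinnertonDyer-24198`). The route
(`Theses/CumulativeHeegnerLeopoldt.lean`, RATIONALE and TWO-LAYER PLAN) repairs the first non-transferring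
step of the Castella–Grossi–(Lee–)Skinner argument at wild additive `3`: «at additive `3`, `a₃ = 0` makes the
Heegner points of `3`-power conductor TRACE-ZERO, so no norm-compatible bounded class exists. The new lever
repairs exactly that step: the cumulative sums `y♮_m = Σ_{k≤m} y_{3^k}` satisfy `Tr y♮_{m+1} = 3·y♮_m`, so
`κ♮ := (3^{-m} y♮_m)_m` IS norm-compatible … with `κ♮(𝟙) = y_K` and `κ♮(χ) = (χ`-resolvent of `y_{3^n})`
for `χ` of exact conductor `3^n`» — listed there as «K1 ⇐ (a) CumulativeClass: … (group-ring identity +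
`a₃ = 0` distribution relation; provable now)».

This file proves the GROUP-RING HALF of (a) — everything that is pure algebra — for an abstract tower:
`R`-modules `A m` (`m ∈ ℕ`; read `A m = E(K_m) ⊗ R`, or `H¹(K_m, T)`, along the layers `K_m` of the
anticyclotomic `ℤ₃`-tower / the ring class fields `K[3^{m+s}]`), `R`-linear maps `res m : A m → A (m+1)`
(restriction) and `tr m : A (m+1) → A m` (trace / corestriction) with `tr m ∘ res m = p •` (degree-`p`
layers; `p : R` arbitrary), a family `y m ∈ A m` (the Heegner points / classes) and a family `c m ∈ A m`
satisfying the CUMULATIVE RECURSION `c 0 = y 0`, `c (m+1) = res m (c m) + y (m+1)` (i.e. `c m = y♮_m =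
Σ_{k ≤ m} res_{k→m} y_k`):

* §1 `existsUnique_cumulative` — the cumulative family exists and is unique (so `y♮` is a definite object;
  no `def` is introduced: consumers carry the recursion as two hypotheses).
* §2 `tr_cumulative_succ` — **`tr m (c (m+1)) = p • c m` whenever `y` is trace-zero** (`tr m (y (m+1)) = 0`);
  `tr_cumulative_succ_iff` — conversely exact `p`-compatibility of `c` FORCES `y` to be trace-zero (the
  lever uses `a₃ = 0` and nothing less); `trIter_cumulative` — `Tr_{m+k→m} c (m+k) = p^k • c m` for any
  family of iterated traces.
* §3 specialisation identities: `apply_cumulative_succ_of_comp_res_eq_zero` — a functional `χ` on level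
  `n+1` that kills everything restricted from level `n` (a PRIMITIVE level-`(n+1)` resolvent) sees only the
  top point: `χ (c (n+1)) = χ (y (n+1))`; the bottom pin `c 0 = y 0` (`κ♮(𝟙) = y_K`) is the recursion's base.
* §3b the group-ring identity that MAKES a resolvent primitive: for a finite group `G` acting `R`-linearly
  (`ρ : G →* End_R M`), a subgroup `H` and a character `χ : G →* R` into a domain, non-trivial on `H`:
  `Σ_{h∈H} χ(h) = 0` (`sum_subgroup_eq_zero_of_exists_ne_one`), `Σ_g χ(g) • ρ(g) x = 0` for every `H`-fixed
  `x` (`sum_smul_apply_eq_zero_of_fixed`, by fibring over `G ⧸ H`), hence `(Σ_g χ(g) • ρ(g)) ∘ res = 0` when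
  `H` fixes the image of `res` (`resolvent_comp_eq_zero_of_fixed`) and the assembled specialisation
  `Σ_g χ(g) • ρ(g) (c (n+1)) = Σ_g χ(g) • ρ(g) (y (n+1))` (`resolvent_cumulative_succ_eq`).
* §4 after inverting `p` (`p * u = 1` in `R`, e.g. `R = ℚ₃`, `ℤ₃[1/3]`): the normalised family
  `κ m := u^m • c m` is GENUINELY norm-compatible, `tr m (κ (m+1)) = κ m` (`tr_normalized_succ`), with
  denominators at most `p^m` at layer `m`: `p^m • κ m = c m` (`pow_smul_normalized`) — temper `≤ 1`.

What is NOT here (honest framing): the Heegner points of `3`-power conductor on `X₀(N)` with `9 ∣ N` and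
their distribution relation `Tr_{K[3^{k+1}]/K[3^k]} y_{3^{k+1}} = U₃ · y_{3^k}` (`= a₃ · y_{3^k} = 0` on the
`f_E`-component) are NOT tree objects (the tree's `KolyvaginHeegnerData` / Gross's trace relation
`X11b.HeegnerTrace.*` are for conductors prime to `N` and INERT `ℓ`); neither are the Kummer maps or the
`Λ`-adic packaging of `κ♮`, the Leopoldt/Lettl coordinate, the reciprocity law (b) or the Kolyvagin-system
bound (c). This is the algebra those steps will instantiate; it closes nothing by itself. THEOREMS ONLY;
no definition, no named fact, no `sorry`; imports Mathlib only. BSD is not proved by any of this.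

References: route-BirchSwinnertonDyer-CumulativeHeegnerLeopoldt, Theses file ll. 58–64, 158–162 (the plan);
[PerrinRiou1987] §3 (norm relations of Heegner points along the anticyclotomic tower); [Howard2004]
§1.2 (Λ-adic Heegner classes from norm-compatible families).
-/

set_option autoImplicit false
-- `…BirchSwinnertonDyer.BirchSwinnertonDyer.Theorems…` is the problem's mandated namespace (D-0017).
set_option linter.dupNamespace false

namespace Summit.BirchSwinnertonDyer.BirchSwinnertonDyer.Theorems.CumulativeHeegnerInclusionAtThreeCumulativeClass

variable {R : Type*} [CommRing R] {A : ℕ → Type*} [∀ m, AddCommGroup (A m)] [∀ m, Module R (A m)]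
  (res : ∀ m, A m →ₗ[R] A (m + 1)) (tr : ∀ m, A (m + 1) →ₗ[R] A m)

/-! ### §1 The cumulative family `y♮` exists and is unique -/

/-- **The cumulative family is well defined**: for every family `y m ∈ A m` there is exactly one family
`c` with `c 0 = y 0` and `c (m+1) = res m (c m) + y (m+1)` — informally `c m = y♮_m = Σ_{k ≤ m} res_{k→m} y_k`
(route TWO-LAYER PLAN (a): «the cumulative sums `y♮_m = Σ_{k≤m} y_{3^k}`»). Consumers carry the two
recursion equations as hypotheses; this lemma says they determine `c`. -/
theorem existsUnique_cumulative (y : ∀ m, A m) :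
    ∃! c : ∀ m, A m, c 0 = y 0 ∧ ∀ m, c (m + 1) = res m (c m) + y (m + 1) := by
  refine ⟨fun m ↦ Nat.rec (motive := fun m ↦ A m) (y 0) (fun m cm ↦ res m cm + y (m + 1)) m,
    ⟨rfl, fun _ ↦ rfl⟩, ?_⟩
  rintro c ⟨h0, hs⟩
  funext m
  induction m with
  | zero => exact h0
  | succ m ih => rw [hs, ih]

/-- The recursion recovers `y` from `c`: `y (m+1) = c (m+1) - res m (c m)` (the top point is the new part of
the cumulative sum). -/
theorem eq_cumulative_succ_sub {y c : ∀ m, A m} (hc : ∀ m, c (m + 1) = res m (c m) + y (m + 1)) (m : ℕ) :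
    y (m + 1) = c (m + 1) - res m (c m) := by
  rw [hc, add_sub_cancel_left]

/-! ### §2 The cumulative resolvent identity `Tr y♮_{m+1} = p · y♮_m` -/

/-- **The cumulative resolvent identity** (route TWO-LAYER PLAN (a), «`Tr y♮_{m+1} = 3·y♮_m`»): on a tower
with degree-`p` layers (`tr m (res m x) = p • x`), if the family `y` is TRACE-ZERO (`tr m (y (m+1)) = 0` —
at wild additive `3`: `Tr_{K[3^{k+1}]/K[3^k]} y_{3^{k+1}} = a₃ · y_{3^k}` with `a₃ = 0`), then its cumulative
family satisfies `tr m (c (m+1)) = p • c m`. Proof: `tr (res c_m + y_{m+1}) = p c_m + 0`. -/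
theorem tr_cumulative_succ (p : R) (htr : ∀ m (x : A m), tr m (res m x) = p • x)
    {y c : ∀ m, A m} (hy : ∀ m, tr m (y (m + 1)) = 0)
    (hc : ∀ m, c (m + 1) = res m (c m) + y (m + 1)) (m : ℕ) :
    tr m (c (m + 1)) = p • c m := by
  rw [hc, map_add, htr, hy, add_zero]

/-- **Trace-zero is exactly what the lever uses**: for a cumulative family `c` of `y` on a tower with
degree-`p` layers, `tr m (c (m+1)) = p • c m` holds IF AND ONLY IF `tr m (y (m+1)) = 0`. -/
theorem tr_cumulative_succ_iff (p : R) (htr : ∀ m (x : A m), tr m (res m x) = p • x)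
    {y c : ∀ m, A m} (hc : ∀ m, c (m + 1) = res m (c m) + y (m + 1)) (m : ℕ) :
    tr m (c (m + 1)) = p • c m ↔ tr m (y (m + 1)) = 0 := by
  rw [hc, map_add, htr, add_eq_left]

/-- **Iterated form `Tr_{m+k → m} y♮_{m+k} = p^k · y♮_m`.** For ANY family of iterated traces
`Tr m k : A (m+k) → A m` with `Tr m 0 = id` and `Tr m (k+1) = Tr m k ∘ tr (m+k)`, a trace-zero `y` has
`Tr m k (c (m+k)) = p ^ k • c m`. -/
theorem trIter_cumulative (p : R) (htr : ∀ m (x : A m), tr m (res m x) = p • x)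
    {y c : ∀ m, A m} (hy : ∀ m, tr m (y (m + 1)) = 0)
    (hc : ∀ m, c (m + 1) = res m (c m) + y (m + 1))
    (Tr : ∀ m k, A (m + k) →ₗ[R] A m) (hTr0 : ∀ m (x : A (m + 0)), Tr m 0 x = x)
    (hTrs : ∀ m k (x : A (m + (k + 1))), Tr m (k + 1) x = Tr m k (tr (m + k) x)) (m k : ℕ) :
    Tr m k (c (m + k)) = p ^ k • c m := by
  induction k with
  | zero =>
    -- `c (m + 0)` is `c m` and `Tr m 0` is the identity
    show Tr m 0 (c m) = p ^ 0 • c m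
    rw [hTr0, pow_zero, one_smul]
  | succ k ih =>
    -- `c (m + (k+1))` is `c ((m+k) + 1)` definitionally; one layer of trace, then the induction hypothesis
    have e : tr (m + k) (c (m + (k + 1))) = p • c (m + k) := tr_cumulative_succ res tr p htr hy hc (m + k)
    rw [hTrs, e, map_smul, ih, smul_smul, pow_succ']

/-! ### §3 Specialisation identities: primitive functionals see only the top point -/

/-- **Primitive specialisation** (route: «`κ♮(χ) = (χ`-resolvent of `y_{3^n})` for `χ` of exact conductor
`3^n`»): an `R`-linear functional `χ` on level `n+1` that vanishes on everything restricted from level `n`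
(`χ ∘ res n = 0` — e.g. the resolvent `Σ_σ χ(σ) σ` of a character of `Gal(K_{n+1}/K)` NOT factoring through
`Gal(K_n/K)`) takes the same value on the cumulative class and on the top point:
`χ (c (n+1)) = χ (y (n+1))`. The bottom pin `c 0 = y 0` (`κ♮(𝟙) = y_K`) is the base of the recursion. -/
theorem apply_cumulative_succ_of_comp_res_eq_zero {B : Type*} [AddCommGroup B] [Module R B] {n : ℕ}
    (χ : A (n + 1) →ₗ[R] B) (hχ : χ ∘ₗ res n = 0)
    {y c : ∀ m, A m} (hc : ∀ m, c (m + 1) = res m (c m) + y (m + 1)) :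
    χ (c (n + 1)) = χ (y (n + 1)) := by
  rw [hc, map_add, ← LinearMap.comp_apply, hχ, LinearMap.zero_apply, zero_add]

/-- **Specialisation two layers up**: a functional on level `n+2` killing `res (n+1)` sees neither `c n`
nor `y (n+1)`: `χ (c (n+2)) = χ (y (n+2))` (the same lemma one level higher, recorded for the shape
`Tr_{n+2→n}`-primitive resolvents take). -/
theorem apply_cumulative_succ_succ_of_comp_res_eq_zero {B : Type*} [AddCommGroup B] [Module R B] {n : ℕ}
    (χ : A (n + 2) →ₗ[R] B) (hχ : χ ∘ₗ res (n + 1) = 0)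
    {y c : ∀ m, A m} (hc : ∀ m, c (m + 1) = res m (c m) + y (m + 1)) :
    χ (c (n + 2)) = χ (y (n + 2)) :=
  apply_cumulative_succ_of_comp_res_eq_zero res χ hχ hc

/-! ### §3b The group-ring identity behind «`χ ∘ res = 0`»: a PRIMITIVE resolvent kills fixed vectors

For a finite group `G` (read `Gal(K_{n+1}/K)`) acting `R`-linearly on `M` (read `A (n+1)`) through
`ρ : G →* End_R M`, a subgroup `H ≤ G` (read `Gal(K_{n+1}/K_n)`, which FIXES everything restricted from
`K_n`) and a multiplicative character `χ : G →* R` into a DOMAIN that is non-trivial on `H` («exact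
conductor»), the `χ`-resolvent `Σ_g χ(g) ρ(g)` kills every `H`-fixed vector: sum over the cosets `gH`, each
contributing `χ(g) (Σ_{h ∈ H} χ(h)) ρ(g) x = 0` by orthogonality (`Σ_{h∈H} χ(h) = 0`, Mathlib
`sum_hom_units_eq_zero`). -/

section Resolvent

open scoped Classical

variable {G : Type*} [Group G] [Fintype G] {M : Type*} [AddCommGroup M] [Module R M]

/-- **Orthogonality on a subgroup**: a character `χ : G →* R` into a domain that is non-trivial on the
subgroup `H` has `Σ_{h ∈ H} χ(h) = 0` (Mathlib's `sum_hom_units_eq_zero` for `χ|_H`). -/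
theorem sum_subgroup_eq_zero_of_exists_ne_one [IsDomain R] (H : Subgroup G) (χ : G →* R)
    (hχ : ∃ h ∈ H, χ h ≠ 1) : ∑ h : H, χ h = 0 := by
  obtain ⟨h₀, hh₀, hne⟩ := hχ
  have h1 : χ.restrict H ≠ 1 := by
    intro h1
    apply hne
    have := DFunLike.congr_fun h1 ⟨h₀, hh₀⟩
    rwa [MonoidHom.restrict_apply, MonoidHom.one_apply] at this
  have h0 := sum_hom_units_eq_zero (χ.restrict H) h1
  simpa only [MonoidHom.restrict_apply] using h0

/-- **A primitive resolvent kills `H`-fixed vectors** (the group-ring identity of TWO-LAYER PLAN (a)): if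
`χ : G →* R` (a domain) is non-trivial on `H ≤ G` and `x ∈ M` is fixed by `ρ(h)` for all `h ∈ H`, then
`Σ_{g ∈ G} χ(g) • ρ(g) x = 0`. Proof: fibre the sum over `G ⧸ H`; the fibre of `q` is `q.out · H`, on
which the summand is `χ(q.out) χ(h) • ρ(q.out) x`, and `Σ_h χ(h) = 0`. -/
theorem sum_smul_apply_eq_zero_of_fixed [IsDomain R] (H : Subgroup G) (χ : G →* R)
    (hχ : ∃ h ∈ H, χ h ≠ 1) (ρ : G →* Module.End R M) (x : M) (hx : ∀ h ∈ H, ρ h x = x) :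
    ∑ g : G, χ g • ρ g x = 0 := by
  -- fibre the sum along `G → G ⧸ H`
  rw [← Finset.sum_fiberwise_of_maps_to (s := (Finset.univ : Finset G)) (t := (Finset.univ : Finset (G ⧸ H)))
    (g := fun g : G ↦ (g : G ⧸ H)) (fun g _ ↦ Finset.mem_univ _)]
  refine Finset.sum_eq_zero fun q _ ↦ ?_
  -- the fibre of `q` is the image of `H` under `h ↦ q.out * h`
  have hfib : (Finset.univ.filter fun g : G ↦ (g : G ⧸ H) = q) =
      (Finset.univ : Finset H).map ⟨fun h : H ↦ q.out * h, fun a b hab ↦ by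
        exact Subtype.ext (mul_left_cancel hab)⟩ := by
    ext g
    simp only [Finset.mem_filter, Finset.mem_univ, true_and, Finset.mem_map, Function.Embedding.coeFn_mk]
    constructor
    · intro hg
      have hmem : q.out⁻¹ * g ∈ H := by
        rw [← QuotientGroup.eq, QuotientGroup.out_eq', hg]
      exact ⟨⟨q.out⁻¹ * g, hmem⟩, by simp⟩
    · rintro ⟨h, rfl⟩
      rw [QuotientGroup.mk_mul_of_mem _ h.2, QuotientGroup.out_eq']
  rw [hfib, Finset.sum_map]
  simp only [Function.Embedding.coeFn_mk, map_mul, Module.End.mul_apply]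
  -- on the fibre: `χ(q.out) χ(h) • ρ(q.out) (ρ h x) = (χ(q.out) χ(h)) • ρ(q.out) x`
  have hterm : ∀ h : H, (χ q.out * χ h) • ρ q.out (ρ (h : G) x) = (χ q.out * χ h) • ρ q.out x :=
    fun h ↦ by rw [hx h h.2]
  simp_rw [hterm, ← Finset.sum_smul, ← Finset.mul_sum, sum_subgroup_eq_zero_of_exists_ne_one H χ hχ,
    mul_zero, zero_smul]

/-- **`χ ∘ res = 0` for a primitive `χ`**, in the shape §3 consumes: if `H ≤ G` fixes the image of an
`R`-linear map `res : A' → M` (restriction from the layer below lands in the `Gal(K_{n+1}/K_n)`-invariants)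
and `χ` is non-trivial on `H`, then the resolvent operator `Σ_g χ(g) • ρ(g)` composed with `res` is zero. -/
theorem resolvent_comp_eq_zero_of_fixed [IsDomain R] (H : Subgroup G) (χ : G →* R)
    (hχ : ∃ h ∈ H, χ h ≠ 1) (ρ : G →* Module.End R M) {A' : Type*} [AddCommGroup A'] [Module R A']
    (res' : A' →ₗ[R] M) (hres : ∀ h ∈ H, ∀ a : A', ρ h (res' a) = res' a) :
    (∑ g : G, χ g • (ρ g : M →ₗ[R] M)) ∘ₗ res' = 0 := by
  ext a
  rw [LinearMap.comp_apply, LinearMap.sum_apply, LinearMap.zero_apply]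
  simp only [LinearMap.smul_apply]
  exact sum_smul_apply_eq_zero_of_fixed H χ hχ ρ (res' a) (fun h hh ↦ hres h hh a)

/-- **The primitive specialisation of the cumulative class, assembled** (route: «`κ♮(χ) =` (`χ`-resolvent
of `y_{3^n}`) for `χ` of exact conductor `3^n`»): with `G` acting on level `n+1` through `ρ`, `H ≤ G` fixing
everything restricted from level `n`, and `χ` non-trivial on `H`, the `χ`-resolvent of the cumulative class
`c (n+1)` equals the `χ`-resolvent of the top point `y (n+1)`. -/
theorem resolvent_cumulative_succ_eq [IsDomain R] {n : ℕ} (H : Subgroup G) (χ : G →* R)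
    (hχ : ∃ h ∈ H, χ h ≠ 1) (ρ : G →* Module.End R (A (n + 1)))
    (hres : ∀ h ∈ H, ∀ a : A n, ρ h (res n a) = res n a)
    {y c : ∀ m, A m} (hc : ∀ m, c (m + 1) = res m (c m) + y (m + 1)) :
    ∑ g : G, χ g • ρ g (c (n + 1)) = ∑ g : G, χ g • ρ g (y (n + 1)) := by
  have h := apply_cumulative_succ_of_comp_res_eq_zero res (∑ g : G, χ g • (ρ g : A (n + 1) →ₗ[R] A (n + 1)))
    (resolvent_comp_eq_zero_of_fixed H χ hχ ρ (res n) hres) hc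
  simpa only [LinearMap.sum_apply, LinearMap.smul_apply] using h

end Resolvent

/-! ### §4 Inverting `p`: the normalised family `κ♮_m = p^{-m} · y♮_m` is norm-compatible of temper `≤ 1` -/

/-- **`κ♮` is norm-compatible** (route: «`κ♮ := (3^{-m} y♮_m)_m` IS norm-compatible»): if `p` is
invertible in `R` (`p * u = 1`; e.g. `R = ℚ₃` or `ℤ₃[1/3]`, the modules being `E(K_m) ⊗ R` /
`H¹(K_m, T) ⊗ R`), then `κ m := u ^ m • c m` satisfies `tr m (κ (m+1)) = κ m` for a trace-zero `y`. -/
theorem tr_normalized_succ (p u : R) (hu : p * u = 1) (htr : ∀ m (x : A m), tr m (res m x) = p • x)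
    {y c : ∀ m, A m} (hy : ∀ m, tr m (y (m + 1)) = 0)
    (hc : ∀ m, c (m + 1) = res m (c m) + y (m + 1)) (m : ℕ) :
    tr m (u ^ (m + 1) • c (m + 1)) = u ^ m • c m := by
  rw [map_smul, tr_cumulative_succ res tr p htr hy hc m, smul_smul, pow_succ, mul_assoc, mul_comm u p, hu,
    mul_one]

/-- **Temper `≤ 1`**: the normalised class at layer `m` has denominator at most `p^m`:
`p ^ m • κ m = c m` (an element of the integral module `A m` before `⊗ R`), `κ m = u ^ m • c m`, `p u = 1`.
(Route NUMBERS: «≤ 1 power of 3 per layer (`v₃(3^{-m}) = −m` against `[K_m:K] = 3^m·h`)».) -/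
theorem pow_smul_normalized (p u : R) (hu : p * u = 1) (c : ∀ m, A m) (m : ℕ) :
    p ^ m • (u ^ m • c m) = c m := by
  rw [smul_smul, ← mul_pow, hu, one_pow, one_smul]

/-- **Norm-compatibility across `k` layers for `κ♮`**: with iterated traces as in `trIter_cumulative`,
`Tr m k (κ (m+k)) = κ m` where `κ m = u ^ m • c m` and `p * u = 1`. -/
theorem trIter_normalized (p u : R) (hu : p * u = 1) (htr : ∀ m (x : A m), tr m (res m x) = p • x)
    {y c : ∀ m, A m} (hy : ∀ m, tr m (y (m + 1)) = 0)
    (hc : ∀ m, c (m + 1) = res m (c m) + y (m + 1))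
    (Tr : ∀ m k, A (m + k) →ₗ[R] A m) (hTr0 : ∀ m (x : A (m + 0)), Tr m 0 x = x)
    (hTrs : ∀ m k (x : A (m + (k + 1))), Tr m (k + 1) x = Tr m k (tr (m + k) x)) (m k : ℕ) :
    Tr m k (u ^ (m + k) • c (m + k)) = u ^ m • c m := by
  rw [map_smul, trIter_cumulative res tr p htr hy hc Tr hTr0 hTrs m k, smul_smul, pow_add, mul_assoc,
    ← mul_pow, mul_comm u p, hu, one_pow, mul_one]

end Summit.BirchSwinnertonDyer.BirchSwinnertonDyer.Theorems.CumulativeHeegnerInclusionAtThreeCumulativeClass
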